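import Summits.CriticalPhenomena.Ising3DConformalLimit.Theses.ArmHyperscaling
import Summits.CriticalPhenomena.Ising3DConformalLimit.Theorems.AnomalousForcesInteractionEtaPositiveOfOneArm
import Literature.Probability.LatticeModels.HighDimPointwiseTriviality
import Literature.Probability.LatticeModels.CriticalTwoPointLower
import Summits.CriticalPhenomena.Ising3DConformalLimit.Theorems.ZoomMonotone.Negative.AxisStructureInsufficient
import Summits.CriticalPhenomena.Ising3DConformalLimit.Theorems.HyperoctahedralRPExistsScaleCovariantLimitGeomPairLimitPos
import Summits.CriticalPhenomena.Ising3DConformalLimit.Theorems.PerfectScreeningScreeningDichotomy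
import HarnessLib

/-!
# `OneArmHyperscaling` (item stmt-CriticalPhenomena-15591): the `K = 0` slice and every exponent `p < 1` are false

Negative / structural knowledge about the crux
`Summit.CriticalPhenomena.Ising3DConformalLimit.Theses.ArmHyperscaling.OneArmHyperscaling`
(route ArmHyperscaling, r2), from the standing crux disprover (cdisprove, cycle 1; work file
`Cruxes/OneArmHyperscaling/Disproof.lean`). THEOREM-ONLY, no new definitions.
Notation: `m⁺_L = ⟨σ₀⟩⁺_{Λ_L;β_c(3),0}` (`isingCorr (zdGraph 3) (box 3 L) (criticalBeta 3) 0 .plus {0}`),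
`G(x) = ⟨σ₀σ_x⟩_{β_c(3)}` (`criticalTwoPoint 3 x`). The crux reads
`∃ K ≥ 1, ∃ C, ∀ n ≥ 1, (m⁺_{Kn})² ≤ C · G(2ne₀)`.

* `oneArmHyperscaling_false_without_hK` — **the hypothesis `1 ≤ K` is load-bearing**: the crux's body
  with `K = 0` (a single-site box for every `n`) is FALSE, since `m⁺_0 > 0` is a constant while
  `G(2ne₀) ≤ C₁/n → 0` (infrared bound). Any proof must use that the box grows with `n`.
* `not_oneArmHyperscalingExp_of_lt_one` — **the natural strengthenings `(m⁺_{Kn})^p ≤ C·G(2ne₀)` with a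
  real exponent `p < 1` are all FALSE** (the crux is `p = 2`; smaller `p` is stronger since `0 < m⁺ ≤ 1`):
  Tasaki's converse `G((2L+2)e₀) ≤ (m⁺_L)²` (landed GKS decoupling
  `twoPointPlus_le_isingCorr_plus_box_sq`) with the Simon–Lieb lower bound `G(x) ≥ c‖x‖⁻²` gives
  `m⁺_L ≥ a/L`, and then `(a/K)^p · n^{1-p} ≤ C·C₁` for all `n`, absurd. Scaling theory predicts the
  family true iff `p ≥ 2`; rigorously it is OPEN for every `p ≥ 1` (a polynomial upper bound on `m⁺_L`
  with ANY exponent is open on `ℤ³`: van Engelenburg–Garban–Panis–Severo, arXiv:2510.23423, after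
  Thm 1.12; Panis, arXiv:2406.15243, §1.4.1), so the crux is the sharp end of a ladder whose weak end is
  already open — the reason no cheap counterexample exists.
* `oneArm_ratio_window` — **the rigorous window**: `c₀/(K²n) ≤ (m⁺_{Kn})²/G(2ne₀) ≤ C₀ n²` for all
  `K, n ≥ 1` (everything GKS + infrared bound + Simon–Lieb + Tasaki give; the crux asserts `≤ C`).

References: H. Tasaki, Comm. Math. Phys. 113 (1987) 49 (hyperscaling inequalities); B. Simon, Comm. Math.
Phys. 77 (1980) 111; J. Fröhlich, B. Simon, T. Spencer, Comm. Math. Phys. 50 (1976) 79; H. Duminil-Copin,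
*Lectures on the Ising and Potts models on the hypercubic lattice* (2019), Thm 4.8; S. Friedli, Y. Velenik,
*Statistical Mechanics of Lattice Systems* (2017), §3.6–3.7, Exercise 3.15.
-/

noncomputable section

namespace Summit.CriticalPhenomena.Ising3DConformalLimit.OneArmHyperscalingNegative

open Literature.Probability.LatticeModels Finset Filter Topology
open Summit.CriticalPhenomena.Ising3DConformalLimit.Theorems.ZoomMonotone.Negative (single_nat_ne_zero)
open Summit.CriticalPhenomena.Ising3DConformalLimit.Cruxes.ExistsScaleCovariantLimit.TwoHierarchies
  (criticalTwoPoint_axis_sq_lower)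
open Summit.CriticalPhenomena.Ising3DConformalLimit.Theorems.PerfectScreening (supNorm_single_natCast)

/-! ### Elementary facts about the two quantities of the crux

(`‖m e₀‖_∞ = m`, `m e₀ ≠ 0` and the Simon–Lieb axis bound `c/m² ≤ G(me₀)` are the landed
`supNorm_single_natCast`, `single_nat_ne_zero`, `criticalTwoPoint_axis_sq_lower`.) -/

/-- `0 ≤ m⁺_L` (GKS I). [cite: FriedliVelenik2017, Thm. 3.20, eq. (3.21), p. 109] -/
theorem boxMag_nonneg (L : ℕ) :
    0 ≤ isingCorr (zdGraph 3) (box 3 L) (criticalBeta 3) 0 .plus ({0} : Finset (Site 3)) :=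
  GKSInequalities.gks_one_holds (zdGraph 3) (criticalBeta_nonneg 3) le_rfl (Or.inr rfl)
    (Finset.singleton_subset_iff.2 (zero_mem_box 3 L))

/-- `m⁺_L ≤ 1`. [folklore] -/
theorem boxMag_le_one (L : ℕ) :
    isingCorr (zdGraph 3) (box 3 L) (criticalBeta 3) 0 .plus ({0} : Finset (Site 3)) ≤ 1 :=
  (abs_le.1 (abs_isingCorr_le_one (zdGraph 3) (box 3 L) (criticalBeta 3) 0 .plus {0})).2

/-- Infrared upper bound along the axis: `G(me₀) ≤ C/m` for `m ≥ 1`. [cite: DuminilCopin2019, Thm. 4.8, §4.4] -/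
theorem axis_upper : ∃ C : ℝ, 0 < C ∧ ∀ m : ℕ, 1 ≤ m →
    criticalTwoPoint 3 (Pi.single 0 (m : ℤ)) ≤ C / m := by
  obtain ⟨C, hC, h⟩ := exists_criticalTwoPoint_le_inv_pow (d := 3) le_rfl
  refine ⟨C + 1, by linarith, fun m hm => ?_⟩
  have h1 := h _ (single_nat_ne_zero hm)
  rw [supNorm_single_natCast] at h1
  have hm0 : (0 : ℝ) < m := by exact_mod_cast hm
  calc criticalTwoPoint 3 (Pi.single 0 (m : ℤ)) ≤ C * ((m : ℝ) ^ (3 - 2))⁻¹ := h1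
    _ = C / m := by norm_num [div_eq_mul_inv]
    _ ≤ (C + 1) / m := by gcongr; linarith

/-- `G(2ne₀) ≤ C₁/n` for `n ≥ 1`. [cite: DuminilCopin2019, Thm. 4.8, §4.4] -/
theorem axisTwoPoint_le : ∃ C₁ : ℝ, 0 < C₁ ∧ ∀ n : ℕ, 1 ≤ n →
    criticalTwoPoint 3 (Pi.single 0 (2 * (n : ℤ))) ≤ C₁ / n := by
  obtain ⟨C, hC, h⟩ := axis_upper
  refine ⟨C, hC, fun n hn => ?_⟩
  have hn0 : (0 : ℝ) < n := by exact_mod_cast hn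
  have h1 := h (2 * n) (by omega)
  have : (Pi.single 0 (((2 * n : ℕ) : ℤ)) : Site 3) = Pi.single 0 (2 * (n : ℤ)) := by push_cast; rfl
  rw [this] at h1
  calc criticalTwoPoint 3 (Pi.single 0 (2 * (n : ℤ))) ≤ C / ((2 * n : ℕ) : ℝ) := h1
    _ ≤ C / n := by
      apply div_le_div_of_nonneg_left hC.le hn0
      push_cast; linarith

/-- `c/n² ≤ G(2ne₀)` for `n ≥ 1`. [cite: DuminilCopin2019, Thm. 4.8, §4.4] -/
theorem le_axisTwoPoint : ∃ c : ℝ, 0 < c ∧ ∀ n : ℕ, 1 ≤ n →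
    c / (n : ℝ) ^ 2 ≤ criticalTwoPoint 3 (Pi.single 0 (2 * (n : ℤ))) := by
  obtain ⟨c, hc, h⟩ := criticalTwoPoint_axis_sq_lower
  refine ⟨c / 4, by positivity, fun n hn => ?_⟩
  have h1 := h (2 * n) (by omega)
  have : (Pi.single 0 (((2 * n : ℕ) : ℤ)) : Site 3) = Pi.single 0 (2 * (n : ℤ)) := by push_cast; rfl
  rw [this] at h1
  calc c / 4 / (n : ℝ) ^ 2 = c / (((2 * n : ℕ) : ℝ)) ^ 2 := by push_cast; ring
    _ ≤ _ := h1

/-- `0 < G(2ne₀)` for `n ≥ 1`. [folklore] -/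
theorem axisTwoPoint_pos {n : ℕ} (hn : 1 ≤ n) : 0 < criticalTwoPoint 3 (Pi.single 0 (2 * (n : ℤ))) := by
  obtain ⟨c, hc, h⟩ := le_axisTwoPoint
  have hn0 : (0 : ℝ) < n := by exact_mod_cast hn
  exact lt_of_lt_of_le (by positivity) (h n hn)

/-- **Tasaki's converse at the crux's scales**: `G((2L+2)e₀) ≤ (m⁺_L)²` (GKS decoupling of the two
boxes `Λ_L` and `(2L+2)e₀ + Λ_L`, landed as `twoPointPlus_le_isingCorr_plus_box_sq`). [cite: FriedliVelenik2017, Exercise 3.15 (solution, App. C)] -/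
theorem axisTwoPoint_far_le_boxMag_sq (L : ℕ) :
    criticalTwoPoint 3 (Pi.single 0 ((2 * L + 2 : ℕ) : ℤ)) ≤
      isingCorr (zdGraph 3) (box 3 L) (criticalBeta 3) 0 .plus ({0} : Finset (Site 3)) ^ 2 :=
  AnomalousForcesInteractionEtaPositive.twoPointPlus_le_isingCorr_plus_box_sq (d := 3)
    (criticalBeta_nonneg 3) (by rw [supNorm_single_natCast])

/-- `0 < m⁺_L` for every `L` (Tasaki + Simon–Lieb). [folklore] -/
theorem boxMag_pos (L : ℕ) :
    0 < isingCorr (zdGraph 3) (box 3 L) (criticalBeta 3) 0 .plus ({0} : Finset (Site 3)) := by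
  obtain ⟨c, hc, h⟩ := criticalTwoPoint_axis_sq_lower
  have h1 := (h (2 * L + 2) (by omega)).trans (axisTwoPoint_far_le_boxMag_sq L)
  have hpos : 0 < c / ((2 * L + 2 : ℕ) : ℝ) ^ 2 := by positivity
  have h2 := hpos.trans_le h1
  rcases (boxMag_nonneg L).lt_or_eq with h3 | h3
  · exact h3
  · rw [← h3] at h2; norm_num at h2

/-- **One-arm lower bound** `m⁺_L ≥ a/L` for `L ≥ 1`, with `0 < a ≤ 1` (the `d = 3` instance of
`m⁺_L ≳ L^{-(d-1)/2}`, Tasaki + Simon–Lieb). [cite: Simon1980, Thm. 1] -/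
theorem boxMag_lower : ∃ a : ℝ, 0 < a ∧ a ≤ 1 ∧ ∀ L : ℕ, 1 ≤ L →
    a / L ≤ isingCorr (zdGraph 3) (box 3 L) (criticalBeta 3) 0 .plus ({0} : Finset (Site 3)) := by
  obtain ⟨c, hc, h⟩ := criticalTwoPoint_axis_sq_lower
  refine ⟨min (Real.sqrt c / 4) 1, by positivity, min_le_right _ _, fun L hL => ?_⟩
  have hL0 : (0 : ℝ) < L := by exact_mod_cast hL
  have hL1 : (1 : ℝ) ≤ L := by exact_mod_cast hL
  have h1 := (h (2 * L + 2) (by omega)).trans (axisTwoPoint_far_le_boxMag_sq L)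
  have h2 := Real.sqrt_le_sqrt h1
  rw [Real.sqrt_sq (boxMag_nonneg L), Real.sqrt_div' _ (by positivity),
    Real.sqrt_sq (by positivity)] at h2
  calc min (Real.sqrt c / 4) 1 / L ≤ Real.sqrt c / 4 / L := by gcongr; exact min_le_left _ _
    _ ≤ Real.sqrt c / ((2 * L + 2 : ℕ) : ℝ) := by
        rw [div_div]
        apply div_le_div_of_nonneg_left (Real.sqrt_nonneg c) (by positivity)
        push_cast; linarith
    _ ≤ _ := h2

/-! ### The rigorous window for the crux's ratio -/

/-- **The rigorous window**: for all `K, n ≥ 1`, `c₀/(K²n) ≤ (m⁺_{Kn})²/G(2ne₀) ≤ C₀ n²`.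
The crux asserts `≤ C`; a refutation needs `→ ∞` for every `K`; the owned inequalities (GKS,
infrared bound, Simon–Lieb, Tasaki) leave a polynomial window of width `n³`. [folklore] -/
theorem oneArm_ratio_window : ∃ c₀ C₀ : ℝ, 0 < c₀ ∧ 0 < C₀ ∧ ∀ K n : ℕ, 1 ≤ K → 1 ≤ n →
    c₀ / ((K : ℝ) ^ 2 * n) ≤
        isingCorr (zdGraph 3) (box 3 (K * n)) (criticalBeta 3) 0 .plus ({0} : Finset (Site 3)) ^ 2 /
          criticalTwoPoint 3 (Pi.single 0 (2 * (n : ℤ))) ∧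
      isingCorr (zdGraph 3) (box 3 (K * n)) (criticalBeta 3) 0 .plus ({0} : Finset (Site 3)) ^ 2 /
          criticalTwoPoint 3 (Pi.single 0 (2 * (n : ℤ))) ≤ C₀ * (n : ℝ) ^ 2 := by
  obtain ⟨a, ha, -, hlow⟩ := boxMag_lower
  obtain ⟨C₁, hC₁, hup⟩ := axisTwoPoint_le
  obtain ⟨c, hc, hG⟩ := le_axisTwoPoint
  refine ⟨a ^ 2 / C₁, 1 / c, by positivity, by positivity, fun K n hK hn => ⟨?_, ?_⟩⟩
  · have hK0 : (0 : ℝ) < K := by exact_mod_cast hK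
    have hn0 : (0 : ℝ) < n := by exact_mod_cast hn
    have hm := hlow (K * n) (Nat.one_le_iff_ne_zero.2 (Nat.mul_ne_zero (by omega) (by omega)))
    have hGpos := axisTwoPoint_pos hn
    rw [div_le_div_iff₀ (by positivity) hGpos]
    have hm2 : (a / ((K * n : ℕ) : ℝ)) ^ 2 ≤
        isingCorr (zdGraph 3) (box 3 (K * n)) (criticalBeta 3) 0 .plus ({0} : Finset (Site 3)) ^ 2 :=
      pow_le_pow_left₀ (by positivity) hm 2
    have hG1 := hup n hn
    calc a ^ 2 / C₁ * criticalTwoPoint 3 (Pi.single 0 (2 * (n : ℤ))) ≤ a ^ 2 / C₁ * (C₁ / n) := by gcongr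
      _ = (a / ((K * n : ℕ) : ℝ)) ^ 2 * ((K : ℝ) ^ 2 * n) := by
          push_cast; field_simp
      _ ≤ _ := by gcongr
  · have hn0 : (0 : ℝ) < n := by exact_mod_cast hn
    have hGpos := axisTwoPoint_pos hn
    have hG1 := hG n hn
    have hm1 : isingCorr (zdGraph 3) (box 3 (K * n)) (criticalBeta 3) 0 .plus
        ({0} : Finset (Site 3)) ^ 2 ≤ 1 := by
      have := boxMag_le_one (K * n)
      have := boxMag_nonneg (K * n)
      nlinarith
    rw [div_le_iff₀ hGpos]
    calc isingCorr (zdGraph 3) (box 3 (K * n)) (criticalBeta 3) 0 .plus ({0} : Finset (Site 3)) ^ 2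
          ≤ 1 := hm1
      _ = 1 / c * (c / (n : ℝ) ^ 2) * (n : ℝ) ^ 2 := by field_simp
      _ ≤ 1 / c * criticalTwoPoint 3 (Pi.single 0 (2 * (n : ℤ))) * (n : ℝ) ^ 2 := by gcongr
      _ = _ := by ring

/-! ### `1 ≤ K` is load-bearing -/

/-- **The `K = 0` slice of the crux is false**: with `K = 0` the box is the single site `{0}` for
every `n`, `m⁺_0 > 0` is constant, while `G(2ne₀) ≤ C₁/n → 0`. (The crux body, verbatim, with
`K := 0`.) [folklore] -/
theorem oneArmHyperscaling_false_without_hK :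
    ¬ ∃ C : ℝ, ∀ n : ℕ, 1 ≤ n →
      (isingCorr (zdGraph 3) (box 3 (0 * n)) (criticalBeta 3) 0 BoundaryCondition.plus
        ({0} : Finset (Site 3))) ^ 2 ≤ C * criticalTwoPoint 3 (Pi.single 0 (2 * (n : ℤ))) := by
  rintro ⟨C, hC⟩
  obtain ⟨C₁, hC₁, hup⟩ := axisTwoPoint_le
  have hm : 0 < isingCorr (zdGraph 3) (box 3 0) (criticalBeta 3) 0 .plus ({0} : Finset (Site 3)) ^ 2 :=
    pow_pos (boxMag_pos 0) 2
  obtain ⟨n, hn⟩ := exists_nat_gt (max C 0 * C₁ /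
    isingCorr (zdGraph 3) (box 3 0) (criticalBeta 3) 0 .plus ({0} : Finset (Site 3)) ^ 2)
  have hn1 : 1 ≤ n + 1 := Nat.succ_le_succ (Nat.zero_le n)
  have hn0 : (0 : ℝ) < (n + 1 : ℕ) := by positivity
  have key := hC (n + 1) hn1
  rw [zero_mul] at key
  have hG := hup (n + 1) hn1
  have hGpos := axisTwoPoint_pos hn1
  have h1 : isingCorr (zdGraph 3) (box 3 0) (criticalBeta 3) 0 .plus ({0} : Finset (Site 3)) ^ 2 ≤
      max C 0 * (C₁ / ((n + 1 : ℕ) : ℝ)) :=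
    key.trans ((mul_le_mul_of_nonneg_right (le_max_left _ _) hGpos.le).trans
      (mul_le_mul_of_nonneg_left hG (le_max_right _ _)))
  rw [← mul_div_assoc, le_div_iff₀ hn0] at h1
  rw [div_lt_iff₀ hm] at hn
  push_cast at h1
  nlinarith

/-- **The slices are monotone in `K`** (`Λ_{Kn} ⊆ Λ_{K'n}`, plus correlations decrease with the
volume): whatever holds at ratio `K` holds at every `K' ≥ K`, so the strongest slice is `K = 1`
(the QT open core `stub_oneArmBound` of crux 1980) and the prover may take `K` large. [cite: FriedliVelenik2017, Exercise 3.15 (solution, App. C)] -/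
theorem oneArmHyperscalingAt_mono {K K' : ℕ} (hKK' : K ≤ K') {C : ℝ}
    (h : ∀ n : ℕ, 1 ≤ n →
      (isingCorr (zdGraph 3) (box 3 (K * n)) (criticalBeta 3) 0 BoundaryCondition.plus
        ({0} : Finset (Site 3))) ^ 2 ≤ C * criticalTwoPoint 3 (Pi.single 0 (2 * (n : ℤ)))) :
    ∀ n : ℕ, 1 ≤ n →
      (isingCorr (zdGraph 3) (box 3 (K' * n)) (criticalBeta 3) 0 BoundaryCondition.plus
        ({0} : Finset (Site 3))) ^ 2 ≤ C * criticalTwoPoint 3 (Pi.single 0 (2 * (n : ℤ))) := by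
  intro n hn
  refine le_trans (pow_le_pow_left₀ (boxMag_nonneg _) ?_ 2) (h n hn)
  exact isingCorr_plus_le_of_subset (zdGraph 3) (criticalBeta_nonneg 3) le_rfl
    (Finset.singleton_subset_iff.2 (zero_mem_box 3 _)) (box_mono 3 (Nat.mul_le_mul_right n hKK'))

/-! ### The exponent ladder: every rung `p < 1` is false -/

/-- **Refuted strengthenings**: for every real `p < 1`, the crux with `(m⁺_{Kn})²` replaced by
`(m⁺_{Kn})^p` is FALSE (`m⁺_{Kn} ≥ a/(Kn)` against `G(2ne₀) ≤ C₁/n`: `(a/K)^p n^{1-p} ≤ C C₁` for all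
`n`, absurd). The crux is the rung `p = 2`; every rung `p ≥ 1` is open. [cite: Simon1980, Thm. 1] -/
theorem not_oneArmHyperscalingExp_of_lt_one {p : ℝ} (hp : p < 1) :
    ¬ ∃ K : ℕ, 1 ≤ K ∧ ∃ C : ℝ, ∀ n : ℕ, 1 ≤ n →
      (isingCorr (zdGraph 3) (box 3 (K * n)) (criticalBeta 3) 0 BoundaryCondition.plus
        ({0} : Finset (Site 3))) ^ p ≤ C * criticalTwoPoint 3 (Pi.single 0 (2 * (n : ℤ))) := by
  rintro ⟨K, hK, C, hC⟩
  obtain ⟨a, ha, ha1, hlow⟩ := boxMag_lower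
  obtain ⟨C₁, hC₁, hup⟩ := axisTwoPoint_le
  have hK0 : (0 : ℝ) < K := by exact_mod_cast hK
  set m : ℕ → ℝ := fun L =>
    isingCorr (zdGraph 3) (box 3 L) (criticalBeta 3) 0 BoundaryCondition.plus ({0} : Finset (Site 3))
    with hmdef
  have hm0 : ∀ L, 0 < m L := fun L => boxMag_pos L
  have hm1 : ∀ L, m L ≤ 1 := fun L => boxMag_le_one L
  set B : ℝ := max C 0 * C₁ with hB
  have hB0 : 0 ≤ B := by positivity
  have step : ∀ n : ℕ, 1 ≤ n → m (K * n) ^ p * n ≤ B := by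
    intro n hn
    have hn0 : (0 : ℝ) < n := by exact_mod_cast hn
    have hGpos := axisTwoPoint_pos hn
    have h1 : m (K * n) ^ p ≤ max C 0 * (C₁ / n) :=
      (hC n hn).trans ((mul_le_mul_of_nonneg_right (le_max_left _ _) hGpos.le).trans
        (mul_le_mul_of_nonneg_left (hup n hn) (le_max_right _ _)))
    rw [← mul_div_assoc, le_div_iff₀ hn0] at h1
    exact h1
  have base : ∀ n : ℕ, 1 ≤ n → a / K / n ≤ m (K * n) := by
    intro n hn
    have h := hlow (K * n) (Nat.one_le_iff_ne_zero.2 (Nat.mul_ne_zero (by omega) (by omega)))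
    rw [div_div]
    exact_mod_cast h
  rcases le_or_gt p 0 with hp0 | hp0
  · obtain ⟨n, hn⟩ := exists_nat_gt B
    have hn1 : 1 ≤ n + 1 := Nat.succ_le_succ (Nat.zero_le n)
    have h1 : (1 : ℝ) ≤ m (K * (n + 1)) ^ p := by
      rw [← Real.rpow_zero (m (K * (n + 1)))]
      exact Real.rpow_le_rpow_of_exponent_ge (hm0 _) (hm1 _) hp0
    have h2 := step (n + 1) hn1
    have hn0 : (0 : ℝ) ≤ (n + 1 : ℕ) := by positivity
    have : ((n + 1 : ℕ) : ℝ) ≤ B := le_trans (by nlinarith) h2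
    push_cast at this
    linarith
  · have hq : 0 < 1 - p := by linarith
    have hAK : 0 < (a / K) ^ p := Real.rpow_pos_of_pos (by positivity) p
    have hev : ∀ᶠ n : ℕ in atTop, B / (a / K) ^ p < (n : ℝ) ^ (1 - p) :=
      ((tendsto_rpow_atTop hq).comp tendsto_natCast_atTop_atTop).eventually_gt_atTop _
    obtain ⟨n, hn, hn1⟩ := (hev.and (eventually_ge_atTop 1)).exists
    have hn0 : (0 : ℝ) < n := by exact_mod_cast hn1
    have h1 : (a / K / n) ^ p ≤ m (K * n) ^ p :=
      Real.rpow_le_rpow (by positivity) (base n hn1) hp0.le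
    have h2 := step n hn1
    have h3 : (a / K / n) ^ p * n ≤ B := le_trans (by gcongr) h2
    rw [Real.div_rpow (by positivity) hn0.le, div_mul_eq_mul_div,
      div_le_iff₀ (Real.rpow_pos_of_pos hn0 p)] at h3
    have h4 : (n : ℝ) ^ (1 - p) ≤ B / (a / K) ^ p := by
      rw [Real.rpow_sub hn0, Real.rpow_one, le_div_iff₀ hAK, div_mul_eq_mul_div,
        div_le_iff₀ (Real.rpow_pos_of_pos hn0 p)]
      linarith
    linarith

/-- In particular the rung `p = 1/2` ("one-arm `≤ C ·` two-point squared") is false. [folklore] -/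
theorem not_oneArmHyperscalingExp_half :
    ¬ ∃ K : ℕ, 1 ≤ K ∧ ∃ C : ℝ, ∀ n : ℕ, 1 ≤ n →
      (isingCorr (zdGraph 3) (box 3 (K * n)) (criticalBeta 3) 0 BoundaryCondition.plus
        ({0} : Finset (Site 3))) ^ (1 / 2 : ℝ) ≤ C * criticalTwoPoint 3 (Pi.single 0 (2 * (n : ℤ))) :=
  not_oneArmHyperscalingExp_of_lt_one (by norm_num)

end Summit.CriticalPhenomena.Ising3DConformalLimit.OneArmHyperscalingNegative

end
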